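import Mathlib
import HarnessLib
import Summits.ValiantsHypothesis.ValiantsHypothesis.Theorems.LacunarySymmetroidMatrixDescartesOsculationLawRankLetterDet

/-!
# ValiantsHypothesis / LacunarySymmetroid — crux `MatrixDescartes` (stmt-ValiantsHypothesis-18050, V1),
# line «osculation-law»: the rank-`r` letter GROUPED BY DEGREE (`Σ_k X₁^k · ι a_k`)

Companion to `…OsculationLawRankLetterDet`: the expansion `det(G + X₁·(I_r ⊕ 0)) = Σ_{U ⊆ inl(Fin r)} X₁^|U| ι(det G[U])`
regrouped by `|U| = k` (`Finset.powerset_card_disjiUnion`), i.e. the letter as an honest degree-`r` polynomial in `X₁`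
with coefficients `a_k = Σ_{|U| = k} det G[U := unit rows]` (`insertionPoly_rank_card`), the top and bottom
coefficients `a_r = det G₂₂`, `a_0 = det G` (`coeff_top`, `coeff_zero`), their supports `supp a_k ⊆ (r + s − k)•E`
(`supp_coeff_card`), and real-rootedness in the grouped form (`prod_roots_pencil_rank_card`).  Honest framing:
bookkeeping only; nothing here bears on `OsculationLaw`, `MatrixDescartes`, Conjecture B or `VP ≠ VNP`.  No
definitions, no named facts; Mathlib + tree osculation files only.
-/

-- `Summit.ValiantsHypothesis.ValiantsHypothesis.…` is the tree's mandated single-conjunct layout (Sub = Summit).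
set_option linter.dupNamespace false

noncomputable section

namespace Summit.ValiantsHypothesis.ValiantsHypothesis.Theorems.LacunarySymmetroidMatrixDescartes

namespace OsculationLetter

open Polynomial
open scoped BigOperators Pointwise

/-- The set of `inl` indices has `r` elements. [folklore] -/
theorem card_inl (r s : ℕ) : (Finset.univ.map Function.Embedding.inl : Finset (Fin r ⊕ Fin s)).card = r := by
  rw [Finset.card_map, Finset.card_univ, Fintype.card_fin]

/-- Regrouping a powerset sum weighted by `x^|U|` by cardinality. [folklore] -/
theorem sum_powerset_pow_card {α M : Type*} [DecidableEq α] [CommSemiring M] (T : Finset α) (x : M) (c : Finset α → M) :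
    ∑ U ∈ T.powerset, x ^ U.card * c U = ∑ k ∈ Finset.range (T.card + 1), x ^ k * ∑ U ∈ T.powersetCard k, c U := by
  rw [Finset.powerset_card_disjiUnion, Finset.sum_disjiUnion]
  refine Finset.sum_congr rfl fun k _ => ?_
  rw [Finset.mul_sum]
  refine Finset.sum_congr rfl fun U hU => ?_
  rw [(Finset.mem_powersetCard.1 hU).2]

/-- **The rank-`r` letter grouped by degree**: `det(Σ X₀^d•S + X₁•(I_r ⊕ 0)) = Σ_{k ≤ r} X₁^k · ι(a_k)`,
`a_k = Σ_{U ⊆ inl(Fin r), |U| = k} det G[U := unit rows]`. [folklore] -/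
theorem insertionPoly_rank_card (r s : ℕ) {K : ℕ} (d : Fin K → ℕ) (S : Fin K → Matrix (Fin r ⊕ Fin s) (Fin r ⊕ Fin s) ℝ) :
    (∑ l, (MvPolynomial.X (0 : Fin 2) : MvPolynomial (Fin 2) ℝ) ^ d l •
              (S l).map (MvPolynomial.C : ℝ →+* MvPolynomial (Fin 2) ℝ)
            + (MvPolynomial.X (1 : Fin 2) : MvPolynomial (Fin 2) ℝ) •
              (Matrix.fromBlocks 1 0 0 0 : Matrix (Fin r ⊕ Fin s) (Fin r ⊕ Fin s) ℝ).map
                (MvPolynomial.C : ℝ →+* MvPolynomial (Fin 2) ℝ)).det =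
      ∑ k ∈ Finset.range (r + 1), (MvPolynomial.X 1 : MvPolynomial (Fin 2) ℝ) ^ k *
        Polynomial.aeval (MvPolynomial.X 0 : MvPolynomial (Fin 2) ℝ)
          (∑ U ∈ (Finset.univ.map Function.Embedding.inl : Finset (Fin r ⊕ Fin s)).powersetCard k,
            (Matrix.of fun i j : Fin r ⊕ Fin s => if i ∈ U then (Pi.single i (1 : ℝ[X]) : Fin r ⊕ Fin s → ℝ[X]) j
              else (∑ l, (X : ℝ[X]) ^ d l • (S l).map Polynomial.C) i j).det) := by
  rw [insertionPoly_rank, sum_powerset_pow_card, card_inl]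
  refine Finset.sum_congr rfl fun k _ => ?_
  rw [map_sum]

/-- The lower-right block of a block pencil is the pencil of the lower-right blocks (any `r`). [folklore] -/
theorem toBlocks₂₂_pencil_gen (r s : ℕ) {K : ℕ} (d : Fin K → ℕ) (S : Fin K → Matrix (Fin r ⊕ Fin s) (Fin r ⊕ Fin s) ℝ) :
    (∑ l, (X : ℝ[X]) ^ d l • (S l).map Polynomial.C).toBlocks₂₂ =
      (∑ l, (X : ℝ[X]) ^ d l • ((S l).toBlocks₂₂).map Polynomial.C) := by
  ext i j
  simp only [Matrix.toBlocks₂₂, Matrix.of_apply, Matrix.sum_apply, Matrix.smul_apply, Matrix.map_apply]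

/-- The top coefficient is `det G₂₂` (the pencil of the lower-right blocks). [folklore] -/
theorem coeff_top (r s : ℕ) {K : ℕ} (d : Fin K → ℕ) (S : Fin K → Matrix (Fin r ⊕ Fin s) (Fin r ⊕ Fin s) ℝ) :
    ∑ U ∈ (Finset.univ.map Function.Embedding.inl : Finset (Fin r ⊕ Fin s)).powersetCard r,
        (Matrix.of fun i j : Fin r ⊕ Fin s => if i ∈ U then (Pi.single i (1 : ℝ[X]) : Fin r ⊕ Fin s → ℝ[X]) j
          else (∑ l, (X : ℝ[X]) ^ d l • (S l).map Polynomial.C) i j).det =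
      (∑ l, (X : ℝ[X]) ^ d l • ((S l).toBlocks₂₂).map Polynomial.C).det := by
  have h := Finset.powersetCard_self (Finset.univ.map Function.Embedding.inl : Finset (Fin r ⊕ Fin s))
  rw [card_inl] at h
  rw [h, Finset.sum_singleton, det_unitRows_inl, toBlocks₂₂_pencil_gen]

/-- The bottom coefficient is `det G`. [folklore] -/
theorem coeff_zero (r s : ℕ) {K : ℕ} (d : Fin K → ℕ) (S : Fin K → Matrix (Fin r ⊕ Fin s) (Fin r ⊕ Fin s) ℝ) :
    ∑ U ∈ (Finset.univ.map Function.Embedding.inl : Finset (Fin r ⊕ Fin s)).powersetCard 0,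
        (Matrix.of fun i j : Fin r ⊕ Fin s => if i ∈ U then (Pi.single i (1 : ℝ[X]) : Fin r ⊕ Fin s → ℝ[X]) j
          else (∑ l, (X : ℝ[X]) ^ d l • (S l).map Polynomial.C) i j).det =
      (∑ l, (X : ℝ[X]) ^ d l • (S l).map Polynomial.C).det := by
  rw [Finset.powersetCard_zero, Finset.sum_singleton]
  congr 1

/-- Supports of the grouped coefficients: `supp a_k ⊆ (r + s − k) • E`. [folklore] -/
theorem supp_coeff_card (r s : ℕ) {K : ℕ} (d : Fin K → ℕ) (S : Fin K → Matrix (Fin r ⊕ Fin s) (Fin r ⊕ Fin s) ℝ)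
    (k : ℕ) :
    (∑ U ∈ (Finset.univ.map Function.Embedding.inl : Finset (Fin r ⊕ Fin s)).powersetCard k,
        (Matrix.of fun i j : Fin r ⊕ Fin s => if i ∈ U then (Pi.single i (1 : ℝ[X]) : Fin r ⊕ Fin s → ℝ[X]) j
          else (∑ l, (X : ℝ[X]) ^ d l • (S l).map Polynomial.C) i j).det).support ⊆
      (r + s - k) • Finset.univ.image d := by
  refine OsculationTwoK.supp_sum _ _ fun U hU => ?_
  rw [← (Finset.mem_powersetCard.1 hU).2]
  exact supp_coeff_rank r s d S U

/-- Real-rootedness in the grouped form: at every `t` with `a_r(t) = det G₂₂(t) ≠ 0`,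
`Σ_k b^k a_k(t) = a_r(t) · ∏ᵢ (b − μᵢ)` for `r` reals `μᵢ`. [folklore] -/
theorem prod_roots_pencil_rank_card (r s : ℕ) {K : ℕ} (d : Fin K → ℕ)
    (S : Fin K → Matrix (Fin r ⊕ Fin s) (Fin r ⊕ Fin s) ℝ) (hS : ∀ l, (S l).IsSymm) (t : ℝ)
    (hD : ((∑ l, (X : ℝ[X]) ^ d l • ((S l).toBlocks₂₂).map Polynomial.C).det).eval t ≠ 0) :
    ∃ μ : Fin r → ℝ, ∀ b : ℝ,
      ∑ k ∈ Finset.range (r + 1), b ^ k *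
        (∑ U ∈ (Finset.univ.map Function.Embedding.inl : Finset (Fin r ⊕ Fin s)).powersetCard k,
          (Matrix.of fun i j : Fin r ⊕ Fin s => if i ∈ U then (Pi.single i (1 : ℝ[X]) : Fin r ⊕ Fin s → ℝ[X]) j
            else (∑ l, (X : ℝ[X]) ^ d l • (S l).map Polynomial.C) i j).det).eval t =
      ((∑ l, (X : ℝ[X]) ^ d l • ((S l).toBlocks₂₂).map Polynomial.C).det).eval t * ∏ i, (b - μ i) := by
  obtain ⟨μ, hμ⟩ := prod_roots_pencil_rank r s d S hS t hD
  refine ⟨μ, fun b => ?_⟩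
  rw [← hμ b, sum_powerset_pow_card, card_inl]
  refine Finset.sum_congr rfl fun k _ => ?_
  rw [eval_finsetSum]

end OsculationLetter

end Summit.ValiantsHypothesis.ValiantsHypothesis.Theorems.LacunarySymmetroidMatrixDescartes
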